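/-
Copyright (c) 2026 the pub-hodgecm-mathlib formalisation cell (harness21).  Prover seat hodgecm-mathlib-K2Liu-p23 (g0), Track B «K2-LIT» ∕ hLiu418
#184♮ = `stmt-HodgeConjecture-24832`; #42S organ S2, S2-asm road (γ), the `hsys` INSTANCE of ★ `K2LiuArchSWSpanningInstance.archSWRegionSpanning_of_readings_on`
(ED. 3), clause (vac) (LEAD F0P6-plan (g14) BATCH #45 2026-09-04T15:02:53Z «K2Liu-p23 → S2 (vac) `archSWValue … Φ_Gauss 1 ≠ 0`»; desk K2Liu-p05 (g6), memo
`CENSUS-hsys-instance.K2Liu-p05-g6.md` §(vac); consumer K2E5-p16 (g7)'s (anc) binder `hvac`).  THEOREMS ONLY.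
-/
import Summits.HodgeConjecture.HodgeConjecture.Theorems.K2LiuArchFrameGaussKType             -- ★ J1 `archFrameGauss` (+ ★ S2-D `archSWValue`)
import Summits.HodgeConjecture.HodgeConjecture.Theorems.K2LiuSWSectionPlaceFactorisation      -- ★ (S4-glob) §1 `apply_zero_piSchwartzBruhatEquiv_tmul`, `piProdSB_apply_zero`
import Literature.NumberTheory.GelbartRogawski1991.DoubledWeilRepresentationDeltaKernel        -- ★ Li's identity: `opD_rDelta_apply_zero_ne_zero_of_diag_nonneg`
import HarnessLib

/-!
# Crux `HLiu418`, #42S organ S2, the `hsys` instance, clause (vac): THE ARCH VALUE OF THE FRAME GAUSSIAN AT THE IDENTITY DOES NOT VANISH —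
# `archSWValue sB 𝟙 Φ_Gauss 1 ≠ 0` (by Li's diagonal-kernel identity `(ω(r_F δ)Ψ)(0) = ∫ Ψ(u,u) du`; no junction, no local Weil datum, no hypothesis on `sB`)

Cell `hodgecm-mathlib`, crux item hLiu418 = `stmt-HodgeConjecture-24832`; squad K2 ∕ K2Liu; LEAD F0P6-plan (g14), S2 desk K2Liu-p05 (g6); prover K2Liu-p23 (g0).
THEOREMS ONLY (no `def`, no instance, no notation, no named-fact hypothesis, no `sorry`); lane `--supports stmt-HodgeConjecture-24832 --as helper`.

WHY.  The packaging ★∕📤 `archSWRegionSpanning_of_readings_on` (ED. 3) asks, per frame, for an anchor `Φ₀` whose compact-picture reading is `C · ∏_w det(v_w)^{m_w}` with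
**`C ≠ 0`**; with `Φ₀ := Φ_Gauss` (★ J1 `archFrameGauss` of the BIG datum `𝔻 ⊗ V′ = (e′, dV, dW ⊗ dV′)`) and the value map `val Φ := archSWValue sB Y (Φ_𝓢 Φ)` (★ S2-D),
`C = archSWValue sB Y Φ_Gauss 1 · (signs)` (K2E5-p16's (anc) reading, binder `hvac`).  THIS FILE proves `archSWValue sB Y Φ_Gauss 1 ≠ 0` for the finite test vector
`Y := 𝟙 = RestrictedFamily.base unitVec` (all unit vectors `1_{𝒪_v^{n′+n′}}`), for EVERY homomorphism `sB` (at the identity `sB` drops out).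
THE MATHEMATICS.  `archSWValue sB Y Φ_∞ 1 = f_{Φ_∞ ⊗ ⊗Y}(1) = (ω^{𝔻⊗V′}(r_F δ · sB 1) Ψ)(0) = (ω^{𝔻⊗V′}(r_F δ) Ψ)(0)`, `Ψ = E(Φ_∞ ⊗ ⊗Y)` (★ `archSWValue_apply`, ★ `swSection`; §2
`archSWValue_one_eq_opD_rDelta`), and by Li's identity [Li1992, (13)] — ★ Literature `GRConstruction.opD_rDelta_apply_zero_ne_zero_of_diag_nonneg` over ★
`Weil1964.AdelicDoublingDeltaOriginValue` — this is `≠ 0` as soon as the diagonal restriction `u ↦ Ψ((u,u))` is a non-negative real function, not identically zero (§2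
`archSWValue_one_ne_zero_of_diag_nonneg`).  For `Ψ = E(Φ_Gauss ⊗ ⊗_v 1_{𝒪_v})`: `Ψ(x) = Φ_Gauss(x_∞) · ∏ᶠ_v 1_{𝒪_v}(x_v)` (★ `coe_piSchwartzBruhatEquiv_tmul`, ★ `coe_piProdSB`) with
`Φ_Gauss(y) = 2^{k/4} e^{−π|·|²} > 0` (§1: ★ `hermitePi_apply`, ★ `herm_zero`, `vac`, `gauss` — the frame transports of ★ `archFrameGauss` only move the argument) and
`∏ᶠ_v 1_{𝒪_v}(x_v) ∈ {0, 1}`, `= 1` at `x = 0` (§1) — so (vac) holds (§3 **`archSWValue_archFrameGauss_one_ne_zero`**).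
* §1 positivity letters: `hermitePi_zero_apply_pos`, `archFrameGauss_apply_pos`, `piProd_base_unitVec_eq_zero_or_one`, `piProdSB_base_unitVec_apply_zero`.
* §2 `archSWValue_one_eq_opD_rDelta` (the arch value at `1` is the doubled vacuum value `(ω(r_F δ)Ψ)(0)`, for every `sB`, `Y`, `Φ_∞`);
  `archSWValue_one_ne_zero_of_diag_nonneg` (Li's criterion at the face).
* §3 **`archSWValue_archFrameGauss_one_ne_zero`** — (vac) for `Y := RestrictedFamily.base unitVec`, any `sB`, any real frame `dV′` (so the `(c • dV₀)`-frames of ED. 3 instantiate).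
References: [Li1992] (13) pp. 181–182 (the diagonal-kernel identity at `δ`); [Weil1964] Chap. III n° 38–41 (restricted products, `r_F`, Thm 6); [KudlaRallis1994] §1 (the
Siegel–Weil section `Φ ↦ f_Φ`); [HarrisKudlaSweet1996] §1 (1.15)–(1.16); [Folland1989] Prop. (4.39) (the vacuum `h₀ = 2^{n/4} e^{−πx²}`); [GelbartRogawski1991] §3.1.
HONEST LABEL.  Count-neutral helper: `HC_CM` is proved only modulo the 7 printed citations (2 remaining named inputs: hLiu418 = `stmt-HodgeConjecture-24832`,
h413 = `stmt-HodgeConjecture-24833`) until rung 0 closes.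
-/

set_option autoImplicit false
set_option linter.dupNamespace false -- the mandated namespace repeats `HodgeConjecture.HodgeConjecture`

noncomputable section

open scoped Matrix TensorProduct Classical ComplexOrder
open NumberField NumberField.InfinitePlace NumberField.mixedEmbedding IsDedekindDomain
open Literature.Analysis.SegalBargmann
open Literature.NumberTheory.Automorphic Literature.NumberTheory.Automorphic.UnitaryGroup Literature.NumberTheory.GaloisRepresentations
open Literature.NumberTheory.Weil1964
open Literature.NumberTheory.GelbartRogawski1991 Literature.NumberTheory.GelbartRogawski1991.GRConstruction
open Literature.NumberTheory.GelbartRogawski1991.UnitaryDualPair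
open Literature.NumberTheory.K2Lit.SiegelDoubled
open Summit.HodgeConjecture.HodgeConjecture.Cruxes.HLiu418.K2LiuArchSWImageDefs
open Summit.HodgeConjecture.HodgeConjecture.Cruxes.HLiu418.K2LiuArchFrameGaussKType (archFrameGauss)
open Summit.HodgeConjecture.HodgeConjecture.Cruxes.HLiu418.K2LiuSWSectionPlaceFactorisation (apply_zero_piSchwartzBruhatEquiv_tmul piProdSB_apply_zero)

namespace Summit.HodgeConjecture.HodgeConjecture.Cruxes.HLiu418.K2LiuArchSWVacuumNonvanishing

/-! ## §1 Positivity letters: the vacuum `h₀`, the frame Gaussian, the unit tensor `⊗_v 1_{𝒪_v}` -/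

section Positivity

/-- **Folland's vacuum is a positive real function**: `h₀(x) = 2^{k/4} e^{−π Σ x_j²}` (★ `hermitePi_apply`, ★ `herm_zero`, `vac = C 2^{k/4}`, `gauss`), so `hermitePi 0 x = r` with `0 < r`.
[cite: Folland1989, Prop. (4.39)] -/
theorem hermitePi_zero_apply_pos {σ : Type} [Fintype σ] [DecidableEq σ] (x : σ → ℝ) :
    ∃ r : ℝ, 0 < r ∧ hermitePi (0 : σ →₀ ℕ) x = (r : ℂ) := by
  refine ⟨vacCoef σ * Real.exp (-(Real.pi * ∑ k, x k ^ 2)), mul_pos vacCoef_pos (Real.exp_pos _), ?_⟩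
  rw [hermitePi_apply, herm_zero, hermiteFun, vac, MvPolynomial.eval_C, gauss, Complex.ofReal_mul, Complex.ofReal_exp]
  congr 1
  congr 1
  push_cast
  ring

variable (L : Type) [Field L] [NumberField L] [IsCMField L]
variable {N M n : ℕ} (e : Fin N × Fin M ≃ Fin n)
  (dV : Fin N → L) (hdV : ∀ i, IsCMField.complexConj L (dV i) = dV i) (hdV0 : ∀ i, dV i ≠ 0)
  (dW : Fin M → L) (hdW : ∀ i, IsCMField.complexConj L (dW i) = dW i) (hdW0 : ∀ i, dW i ≠ 0)

/-- **the frame Gaussian is a positive real function**: `Φ_Gauss = e_D^*(archIdx_* h₀)` is the vacuum read at a transported argument (★ `schwartzTransport_symm_apply`,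
★ `schwartzTransport_apply`), hence `Φ_Gauss(y) = r > 0`. [cite: Folland1989, Prop. (4.39)] [cite: Weil1964, Chap. III n° 37] -/
theorem archFrameGauss_apply_pos (y : Fin (n + n) → mixedSpace (Fp L)) :
    ∃ r : ℝ, 0 < r ∧ archFrameGauss L e dV hdV hdV0 dW hdW hdW0 y = (r : ℂ) := by
  simp only [archFrameGauss, schwartzTransport_symm_apply, schwartzTransport_apply]
  exact hermitePi_zero_apply_pos _

/-- **the unit pure tensor takes the values `0` and `1` only**: `(⊗_v 1_{𝒪_v^ι})(x) = ∏ᶠ_v 1_{𝒪_v^ι}(x_v) ∈ {0, 1}` (every local factor is an indicator value;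
★ `piProd_eq_zero_of_localFactor_eq_zero`, `finprod_eq_one_of_forall_eq_one`). [cite: Weil1964, Chap. III n° 38 p. 190] -/
theorem piProd_base_unitVec_eq_zero_or_one (K : Type) [Field K] [NumberField K] (ι : Type) [Finite ι] (x : ι → FiniteAdeleRing (𝓞 K) K) :
    piProd K ι (RestrictedFamily.base (fun v : HeightOneSpectrum (𝓞 K) => unitVec K ι v)) x = 0 ∨
      piProd K ι (RestrictedFamily.base (fun v : HeightOneSpectrum (𝓞 K) => unitVec K ι v)) x = 1 := by
  by_cases h : ∃ v, localFactor (RestrictedFamily.base (fun v : HeightOneSpectrum (𝓞 K) => unitVec K ι v)) x v = 0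
  · obtain ⟨v, hv⟩ := h
    exact Or.inl (piProd_eq_zero_of_localFactor_eq_zero _ x v hv)
  · refine Or.inr (finprod_eq_one_of_forall_eq_one fun v => ?_)
    have hv : localFactor (RestrictedFamily.base (fun v : HeightOneSpectrum (𝓞 K) => unitVec K ι v)) x v ≠ 0 := fun hv0 => h ⟨v, hv0⟩
    rw [localFactor_apply, RestrictedFamily.base_apply] at hv ⊢
    by_cases hz : (fun i => x i v) ∈ integralBox K ι v
    · exact unitVec_apply_of_mem hz
    · exact absurd (unitVec_apply_of_notMem hz) hv

/-- **the unit pure tensor is `1` at the origin**: `(⊗_v 1_{𝒪_v^ι})(0) = ∏ᶠ_v 1_{𝒪_v^ι}(0) = 1` (★ `piProdSB_apply_zero`, ★ `zero_mem_integralBox`). [cite: Weil1964, Chap. III n° 38 p. 190] -/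
theorem piProdSB_base_unitVec_apply_zero (K : Type) [Field K] [NumberField K] (ι : Type) [Finite ι] :
    ((piProdSB K ι (RestrictedFamily.base (fun v : HeightOneSpectrum (𝓞 K) => unitVec K ι v)) : FinSB K ι) : (ι → FiniteAdeleRing (𝓞 K) K) → ℂ) 0 = 1 := by
  rw [piProdSB_apply_zero]
  exact finprod_eq_one_of_forall_eq_one fun v => by
    rw [RestrictedFamily.base_apply]
    exact unitVec_apply_of_mem (zero_mem_integralBox K ι v)

end Positivity

/-! ## §2 The arch value at the identity is the doubled vacuum value `(ω^{𝔻⊗V′}(r_F δ) Ψ)(0)`; Li's criterion at the face -/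

section Identity

variable (L : Type) [Field L] [NumberField L] [IsCMField L]
variable {N M n : ℕ} (e : Fin N × Fin M ≃ Fin n)
  (dV : Fin N → L) (hdV : ∀ i, IsCMField.complexConj L (dV i) = dV i) (hdV0 : ∀ i, dV i ≠ 0)
  (dW : Fin M → L) (hdW : ∀ i, IsCMField.complexConj L (dW i) = dW i) (hdW0 : ∀ i, dW i ≠ 0)
variable {M₂ M' n' : ℕ} (eW : Fin M × Fin M₂ ≃ Fin M') (e' : Fin N × Fin M' ≃ Fin n')
  (dV' : Fin M₂ → L) (hdV' : ∀ k, IsCMField.complexConj L (dV' k) = dV' k) (hdV'0 : ∀ k, dV' k ≠ 0)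
variable (sB : HA L e' dV hdV (tensorFrame L dW eW dV') (tensorFrame_real L dW hdW eW dV' hdV') →*
  MpD L e' dV hdV (tensorFrame L dW eW dV') (tensorFrame_real L dW hdW eW dV' hdV'))

set_option maxHeartbeats 400000 in -- MEASURED: the default 200000 times out at `exact mul_one _` on the big datum's `MpD` carrier (cf. ★ K2Lit `SiegelWeilSectionLine`); 400000 passes
/-- **THE ARCH VALUE AT THE IDENTITY IS THE DOUBLED VACUUM VALUE**: `archSWValue sB Y Φ_∞ 1 = (ω^{𝔻⊗V′}(r_F δ) (E(Φ_∞ ⊗ ⊗Y)))(0)` — for EVERY homomorphism `sB` (`archToAdelic 1 = 1`,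
`tensorEmb 1 = 1`, `sB 1 = 1`: ★ `archSWValue_apply`, ★ `swSectionTensor_apply`, ★ `swSection`). [cite: KudlaRallis1994, §1] [cite: HarrisKudlaSweet1996, §1 (1.15)–(1.16)] -/
theorem archSWValue_one_eq_opD_rDelta (Y : LocalSBFamily (Fp L) (Fin (n' + n'))) (Φinf : SchwartzMap (Fin (n' + n') → mixedSpace (Fp L)) ℂ) :
    archSWValue L e dV hdV hdV0 dW hdW hdW0 eW e' dV' hdV' hdV'0 sB Y Φinf 1 =
      opD L e' dV hdV (tensorFrame L dW eW dV') (tensorFrame_real L dW hdW eW dV' hdV')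
        (rDelta L e' dV hdV hdV0 (tensorFrame L dW eW dV') (tensorFrame_real L dW hdW eW dV' hdV') (tensorFrame_ne_zero L dW eW dV' hdW0 hdV'0))
        (piSchwartzBruhatEquiv (Fp L) (Fin (n' + n')) (Φinf ⊗ₜ piProdSB (Fp L) (Fin (n' + n')) Y)) 0 := by
  have h1 : UnitaryGroup.archToAdelic (Fp L) L (IsCMField.complexConj L) (n + n) (hermD L e dV hdV dW hdW) 1 = (1 : HA L e dV hdV dW hdW) := map_one _
  have h2 : tensorEmb L e dV hdV dW hdW eW e' dV' hdV' 1 = 1 := map_one _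
  have h3 : rDelta L e' dV hdV hdV0 (tensorFrame L dW eW dV') (tensorFrame_real L dW hdW eW dV' hdV') (tensorFrame_ne_zero L dW eW dV' hdW0 hdV'0) * sB 1 =
      rDelta L e' dV hdV hdV0 (tensorFrame L dW eW dV') (tensorFrame_real L dW hdW eW dV' hdV') (tensorFrame_ne_zero L dW eW dV' hdW0 hdV'0) := by
    rw [map_one sB]
    exact mul_one _
  rw [archSWValue_apply, h1, swSectionTensor_apply, h2, swSection, h3]

/-- **LI'S CRITERION AT THE FACE**: if the diagonal restriction `u ↦ Ψ((u,u) ∘ e₂⁻¹)` of `Ψ = E(Φ_∞ ⊗ ⊗Y)` is a non-negative real function, not identically zero, then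
`archSWValue sB Y Φ_∞ 1 ≠ 0` (§2 + ★ Literature `opD_rDelta_apply_zero_ne_zero_of_diag_nonneg`: `(ω(r_F δ)Ψ)(0) = ∫ Ψ(u,u) du > 0`).
[cite: Li1992, (13) pp. 181–182] [cite: Weil1964, Chap. III n° 41 Thm 6 p. 193] -/
theorem archSWValue_one_ne_zero_of_diag_nonneg (Y : LocalSBFamily (Fp L) (Fin (n' + n'))) (Φinf : SchwartzMap (Fin (n' + n') → mixedSpace (Fp L)) ℂ)
    (h0 : ∀ u : Fin n' → AdeleRing (𝓞 (Fp L)) (Fp L),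
      0 ≤ ((piSchwartzBruhatEquiv (Fp L) (Fin (n' + n')) (Φinf ⊗ₜ piProdSB (Fp L) (Fin (n' + n')) Y) : ↥(piSchwartzBruhat (Fp L) (Fin (n' + n')))) :
        (Fin (n' + n') → AdeleRing (𝓞 (Fp L)) (Fp L)) → ℂ) (fun i => Sum.elim u u (finSumFinEquiv.symm i)))
    (hne : ∃ u : Fin n' → AdeleRing (𝓞 (Fp L)) (Fp L),
      ((piSchwartzBruhatEquiv (Fp L) (Fin (n' + n')) (Φinf ⊗ₜ piProdSB (Fp L) (Fin (n' + n')) Y) : ↥(piSchwartzBruhat (Fp L) (Fin (n' + n')))) :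
        (Fin (n' + n') → AdeleRing (𝓞 (Fp L)) (Fp L)) → ℂ) (fun i => Sum.elim u u (finSumFinEquiv.symm i)) ≠ 0) :
    archSWValue L e dV hdV hdV0 dW hdW hdW0 eW e' dV' hdV' hdV'0 sB Y Φinf 1 ≠ 0 := by
  rw [archSWValue_one_eq_opD_rDelta]
  exact opD_rDelta_apply_zero_ne_zero_of_diag_nonneg L e' dV hdV hdV0 (tensorFrame L dW eW dV') (tensorFrame_real L dW hdW eW dV' hdV')
    (tensorFrame_ne_zero L dW eW dV' hdW0 hdV'0) _ h0 hne

end Identity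

/-! ## §3 (vac): the frame Gaussian against the unit finite vector -/

section Vacuum

variable (L : Type) [Field L] [NumberField L] [IsCMField L]
variable {N M n : ℕ} (e : Fin N × Fin M ≃ Fin n)
  (dV : Fin N → L) (hdV : ∀ i, IsCMField.complexConj L (dV i) = dV i) (hdV0 : ∀ i, dV i ≠ 0)
  (dW : Fin M → L) (hdW : ∀ i, IsCMField.complexConj L (dW i) = dW i) (hdW0 : ∀ i, dW i ≠ 0)
variable {M₂ M' n' : ℕ} (eW : Fin M × Fin M₂ ≃ Fin M') (e' : Fin N × Fin M' ≃ Fin n')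
  (dV' : Fin M₂ → L) (hdV' : ∀ k, IsCMField.complexConj L (dV' k) = dV' k) (hdV'0 : ∀ k, dV' k ≠ 0)
variable (sB : HA L e' dV hdV (tensorFrame L dW eW dV') (tensorFrame_real L dW hdW eW dV' hdV') →*
  MpD L e' dV hdV (tensorFrame L dW eW dV') (tensorFrame_real L dW hdW eW dV' hdV'))

/-- **(vac) THE ARCH VALUE OF THE FRAME GAUSSIAN AT THE IDENTITY DOES NOT VANISH**: for the frame Gaussian `Φ_Gauss` of the big datum `𝔻 ⊗ V′` (★ J1 `archFrameGauss`) and the unit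
finite test vector `𝟙 = (1_{𝒪_v^{n′+n′}})_v` (`RestrictedFamily.base unitVec`), `archSWValue sB 𝟙 Φ_Gauss 1 ≠ 0` — for EVERY homomorphism `sB` and every real frame `dV′`.  (§2's criterion:
`E(Φ_Gauss ⊗ 𝟙)(x) = Φ_Gauss(x_∞) · ∏ᶠ_v 1_{𝒪_v}(x_v)` is `≥ 0` by §1, and at `x = 0` it is `Φ_Gauss(0) · 1 ≠ 0`.)  This is the `hvac` binder of the (anc) reading and the `rd Φ₀ 1 ≠ 0`
clause of ★ (G3) `K2LiuArchSWMultiPlaceRegion`'s abstract system. [cite: Li1992, (13) pp. 181–182] [cite: KudlaRallis1994, §1] [cite: Folland1989, Prop. (4.39)] -/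
theorem archSWValue_archFrameGauss_one_ne_zero :
    archSWValue L e dV hdV hdV0 dW hdW hdW0 eW e' dV' hdV' hdV'0 sB
        (RestrictedFamily.base (fun v : HeightOneSpectrum (𝓞 (Fp L)) => unitVec (Fp L) (Fin (n' + n')) v))
        (archFrameGauss L e' dV hdV hdV0 (tensorFrame L dW eW dV') (tensorFrame_real L dW hdW eW dV' hdV') (tensorFrame_ne_zero L dW eW dV' hdW0 hdV'0)) 1 ≠ 0 := by
  refine archSWValue_one_ne_zero_of_diag_nonneg L e dV hdV hdV0 dW hdW hdW0 eW e' dV' hdV' hdV'0 sB _ _ (fun u => ?_) ⟨0, ?_⟩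
  · -- non-negativity on the diagonal (indeed everywhere)
    rw [coe_piSchwartzBruhatEquiv_tmul, coe_piProdSB]
    obtain ⟨r, hr, hre⟩ := archFrameGauss_apply_pos L e' dV hdV hdV0 (tensorFrame L dW eW dV') (tensorFrame_real L dW hdW eW dV' hdV')
      (tensorFrame_ne_zero L dW eW dV' hdW0 hdV'0) (piArch (Fp L) (Fin (n' + n')) (fun i => Sum.elim u u (finSumFinEquiv.symm i)))
    beta_reduce
    rw [hre]
    rcases piProd_base_unitVec_eq_zero_or_one (Fp L) (Fin (n' + n')) (piFinite (Fp L) (Fin (n' + n')) (fun i => Sum.elim u u (finSumFinEquiv.symm i))) with h | h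
    · rw [h, mul_zero]
    · rw [h, mul_one]
      exact Complex.zero_le_real.2 hr.le
  · -- non-vanishing at the origin
    have hdiag : (fun i : Fin (n' + n') => Sum.elim (0 : Fin n' → AdeleRing (𝓞 (Fp L)) (Fp L)) (0 : Fin n' → AdeleRing (𝓞 (Fp L)) (Fp L)) (finSumFinEquiv.symm i)) = 0 :=
      funext fun i => by rcases finSumFinEquiv.symm i with j | j <;> rfl
    rw [hdiag, apply_zero_piSchwartzBruhatEquiv_tmul, piProdSB_base_unitVec_apply_zero, mul_one]
    obtain ⟨r, hr, hre⟩ := archFrameGauss_apply_pos L e' dV hdV hdV0 (tensorFrame L dW eW dV') (tensorFrame_real L dW hdW eW dV' hdV')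
      (tensorFrame_ne_zero L dW eW dV' hdW0 hdV'0) 0
    rw [hre]
    exact Complex.ofReal_ne_zero.2 hr.ne'

end Vacuum

end Summit.HodgeConjecture.HodgeConjecture.Cruxes.HLiu418.K2LiuArchSWVacuumNonvanishing

end
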